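import Literature.Barriers.CriticalPhenomena.TimarNiceEvent
import Literature.Probability.Percolation.DeletionTolerance
import HarnessLib

/-!
# Timár 2006, proof of Thm. 4.3: if light infinite clusters exist, a NICE light infinite cluster
# at `o` has positive probability (uppermost vertex, automorphism, surgery at `o`) — PROVED

Barrier catalogue `Literature/Barriers/CriticalPhenomena/`; continues `TimarNiceEvent.lean`
towards `Timar2006_noInfiniteLightClusters_holds`. Á. Timár, Ann. Probab. 34 (2006)
2344–2364, proof of Thm. 4.3, p. 2354:

> "We say that `C(x)` is nice if `C(x) = C(x)|G′(x)`. Let `F(x)` be the event that `C(x)` is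
> infinite, light and nice. Note that the probability of `F(x) =: F` is independent of `x` … By
> insertion and deletion tolerance and the assumption that there are light clusters, we have
> `q := P[F] > 0`. To see this, consider the event that `o′` is an uppermost vertex of a light
> cluster, insert the edge between `o` and `o′` and delete all other edges incident to `o`. In the
> resulting configurations (a set of positive probability), `C(o)` is nice."

`measure_nice_pos`: for `0 < p < 1` on a connected, locally finite, transitive nonunimodular
graph, if it is NOT the case that a.s. every infinite cluster is heavy, then
`P_p(C(o) infinite, light, and C(o) ⊆ {o} ∪ {w ≤ Δ}) > 0` (our vertex-set form of niceness:
`ℓ_1(o)` is the level of weight `Δ = minNbrWeight`). Steps as printed: a light infinite cluster has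
an uppermost vertex (finitely many vertices above any level); by countable additivity some fixed
`u` is uppermost in its light infinite cluster with positive probability; an automorphism moves
`u` to a neighbour `o′` of `o` with `w(o′) = Δ` (`openCluster_relabel_image`, invariance of `P_p`);
deleting the edges at `o` and inserting `{o, o′}` (finite energy: the tree's
`bondPercolation_real_pos_of_closeEdges`, `bondPercolation_real_pos_of_openEdges`) turns `C(o)` into `{o} ∪ C(o′)`, which is infinite,
light and nice (`openCluster_surgery_eq`).

## References

* Á. Timár, Ann. Probab. 34 (2006) 2344–2364 (arXiv:math/0702875), §4, proof of Thm. 4.3,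
  p. 2354. [Timar2006]
* B. Bollobás, O. Riordan, *Percolation*, CUP 2006, Ch. 5 (insertion/deletion tolerance).
  [BollobasRiordan2006]
-/

noncomputable section

namespace Literature.Barriers.CriticalPhenomena

open _root_.MeasureTheory Literature.Probability.Percolation
open scoped _root_.ENNReal

variable {V : Type*}

/-! ### Clusters and weights under automorphisms -/

section Aut

variable {G : SimpleGraph V} [G.LocallyFinite] {o : V} (hconn : G.Connected)

omit [G.LocallyFinite] in
/-- **Relabelling carries clusters to clusters**: `C_{e ω}(e x) = e(C_ω(x))` (the statement of
`SubexponentialGrowthZdFiniteTrees.openCluster_relabel`, re-proved here to keep the imports of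
this brick small). [folklore] -/
theorem openCluster_relabel_image (e : V ≃ V) (ω : BondConfig V) (x : V) :
    openCluster (BondConfig.relabel (sym2Equiv e) ω) (e x) = e '' openCluster ω x := by
  let φ : openGraph ω ≃g openGraph (BondConfig.relabel (sym2Equiv e) ω) :=
    { toEquiv := e
      map_rel_iff' := fun {u v} => openGraph_relabel_adj_iff e ω u v }
  ext y'
  simp only [Set.mem_image, openCluster, Set.mem_setOf_eq]
  constructor
  · intro h
    refine ⟨e.symm y', ?_, e.apply_symm_apply y'⟩
    refine (SimpleGraph.Iso.reachable_iff (φ := φ)).1 ?_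
    change (openGraph (BondConfig.relabel (sym2Equiv e) ω)).Reachable (e x) (e (e.symm y'))
    rwa [e.apply_symm_apply]
  · rintro ⟨y, hy, rfl⟩
    exact (SimpleGraph.Iso.reachable_iff (φ := φ)).2 hy

omit [G.LocallyFinite] in
/-- `openCluster_relabel_image` for a graph automorphism `γ` (coercion bookkeeping). [folklore] -/
theorem openCluster_relabel_iso (γ : G ≃g G) (ω : BondConfig V) (x : V) :
    openCluster (BondConfig.relabel (sym2Equiv γ.toEquiv) ω) (γ x) = γ '' openCluster ω x :=
  openCluster_relabel_image γ.toEquiv ω x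

include hconn

/-- Weight comparisons are invariant: `w(γ v) ≤ w(γ u) ↔ w(v) ≤ w(u)`. [folklore] -/
theorem autWeight_map_le_map_iff (γ : G ≃g G) (u v : V) :
    autWeight G o (γ v) ≤ autWeight G o (γ u) ↔ autWeight G o v ≤ autWeight G o u := by
  have h1 := autWeight_map_mul G hconn γ o v o
  have h2 := autWeight_map_mul G hconn γ o u o
  rw [autWeight_self G hconn o, mul_one] at h1 h2
  rw [h1, h2]
  exact ENNReal.mul_le_mul_iff_right (autWeight_ne_zero G hconn o _) (autWeight_ne_top G hconn o _)

end Aut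

/-! ### Uppermost vertices; the surgery at `o` -/

section Surgery

variable {G : SimpleGraph V} [G.LocallyFinite] {o : V} (hconn : G.Connected)
include hconn

/-- **A light cluster has an uppermost vertex**: some `u ∈ C(x)` has `w(v) ≤ w(u)` for all
`v ∈ C(x)` (only finitely many vertices of a light set lie above the level of `x`).
[cite: Timar2006, §4 (proof of Thm. 4.3: "o′ is an uppermost vertex of a light cluster")] -/
theorem exists_uppermost_of_light {ω : BondConfig V} {x : V} (hlight : ¬ IsHeavy G o (openCluster ω x)) :
    ∃ u ∈ openCluster ω x, ∀ v ∈ openCluster ω x, autWeight G o v ≤ autWeight G o u := by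
  have hfin := finite_inter_of_not_isHeavy hlight (autWeight_ne_zero G hconn o x)
  have hne : (openCluster ω x ∩ {v | autWeight G o x ≤ autWeight G o v}).Nonempty :=
    ⟨x, mem_openCluster_self ω x, show autWeight G o x ≤ autWeight G o x from le_rfl⟩
  obtain ⟨u, hu⟩ := hfin.exists_maximalFor (autWeight G o) _ hne
  refine ⟨u, hu.1.1, fun v hv => ?_⟩
  by_cases hvx : autWeight G o x ≤ autWeight G o v
  · rcases le_total (autWeight G o u) (autWeight G o v) with h | h
    · exact hu.2 ⟨hv, hvx⟩ h
    · exact h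
  · exact ((not_le.1 hvx).le).trans hu.1.2

omit [G.LocallyFinite] hconn in
/-- `W({o} ∪ C) ≤ w(o) + W(C)`: adding one vertex keeps a light set light. [folklore] -/
theorem setWeight_insert_self_le (b : V) (C : Set V) :
    setWeight G b (insert o C) ≤ autWeight G b o + setWeight G b C := by
  have h1 : setWeight G b {o} = autWeight G b o := by
    rw [setWeight, tsum_eq_single o]
    · exact Set.indicator_of_mem (Set.mem_singleton o) _
    · intro v hv
      exact Set.indicator_of_notMem (fun h => hv (Set.mem_singleton_iff.1 h)) _
  rw [← h1, setWeight, setWeight, setWeight, ← ENNReal.tsum_add]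
  refine ENNReal.tsum_le_tsum fun v => ?_
  by_cases hv : v ∈ insert o C
  · rcases hv with rfl | hvC
    · rw [Set.indicator_of_mem (Set.mem_insert _ _), Set.indicator_of_mem (Set.mem_singleton _)]
      exact le_self_add
    · rw [Set.indicator_of_mem (Set.mem_insert_of_mem _ hvC), Set.indicator_of_mem hvC]
      exact le_add_self
  · rw [Set.indicator_of_notMem hv]; exact zero_le

omit [G.LocallyFinite] hconn in
/-- **The surgery at `o`**: if `o ∉ C_ω(o′)` and `ω ⊆ E(G)`, then after deleting all edges of
`G` at `o` and inserting `{o, o′}`, the cluster of `o` is exactly `{o} ∪ C_ω(o′)` ("insert the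
edge between `o` and `o′` and delete all other edges incident to `o`", p. 2354).
[cite: Timar2006, §4 (proof of Thm. 4.3: the surgery making C(o) nice)] -/
theorem openCluster_surgery_eq [DecidableEq V] [Fintype (G.neighborSet o)] {ω : BondConfig V}
    (hω : ω ⊆ G.edgeSet) {o' : V} (hoo' : G.Adj o o') (ho : o ∉ openCluster ω o') :
    openCluster ((ω \ ↑((G.neighborFinset o).image fun v => s(o, v))) ∪ {s(o, o')}) o =
      insert o (openCluster ω o') := by
  set D : Finset (Sym2 V) := (G.neighborFinset o).image fun v => s(o, v) with hD
  set ω₂ : BondConfig V := (ω \ ↑D) ∪ {s(o, o')} with hω₂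
  -- an `ω`-walk from `o′` never meets `o`, hence survives in `ω₂`
  have hstay : ∀ {a b : V} (_ : (openGraph ω).Walk a b), a ∈ openCluster ω o' →
      (openGraph ω₂).Reachable a b := by
    intro a b q
    induction q with
    | nil => exact fun _ => SimpleGraph.Reachable.refl _
    | @cons a c b hadj _ ih =>
      intro ha
      have hc : c ∈ openCluster ω o' := ha.trans hadj.reachable
      rw [openGraph_adj] at hadj
      have hao : a ≠ o := fun h => ho (h ▸ ha)
      have hco : c ≠ o := fun h => ho (h ▸ hc)
      have hnotD : s(a, c) ∉ (↑D : Set (Sym2 V)) := by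
        intro h
        obtain ⟨v, -, hv⟩ := Finset.mem_image.1 (Finset.mem_coe.1 h)
        rcases Sym2.eq_iff.1 hv with ⟨h1, -⟩ | ⟨h1, -⟩
        · exact hao h1.symm
        · exact hco h1.symm
      have hadj₂ : (openGraph ω₂).Adj a c := by
        rw [openGraph_adj]
        exact ⟨Or.inl ⟨hadj.1, hnotD⟩, hadj.2⟩
      exact hadj₂.reachable.trans (ih hc)
  -- conversely an `ω₂`-walk from `o` stays in `{o} ∪ C_ω(o′)`
  have hback : ∀ {a b : V} (_ : (openGraph ω₂).Walk a b), a ∈ insert o (openCluster ω o') →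
      b ∈ insert o (openCluster ω o') := by
    intro a b q
    induction q with
    | nil => exact id
    | @cons a c b hadj _ ih =>
      intro ha
      apply ih
      rw [openGraph_adj] at hadj
      obtain ⟨hmem, hac⟩ := hadj
      rcases hmem with ⟨hω₁, hnotD⟩ | hoo
      · -- an edge of `ω` off `o`
        have hG : G.Adj a c := (SimpleGraph.mem_edgeSet G).1 (hω hω₁)
        have hao : a ≠ o := by
          rintro rfl
          exact hnotD (Finset.mem_coe.2 (Finset.mem_image.2
            ⟨c, (G.mem_neighborFinset a c).2 hG, rfl⟩))
        have hco : c ≠ o := by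
          rintro rfl
          exact hnotD (Finset.mem_coe.2 (Finset.mem_image.2
            ⟨a, (G.mem_neighborFinset c a).2 hG.symm, Sym2.eq_swap⟩))
        rcases ha with rfl | haC
        · exact absurd rfl hao
        · exact Or.inr (haC.trans (SimpleGraph.Adj.reachable ((openGraph_adj ω a c).2 ⟨hω₁, hac⟩)))
      · -- the inserted edge
        rw [Set.mem_singleton_iff] at hoo
        rcases Sym2.eq_iff.1 hoo with ⟨-, hc⟩ | ⟨-, hc⟩
        · rw [hc]; exact Or.inr (mem_openCluster_self ω o')
        · exact Or.inl hc
  ext v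
  constructor
  · intro hv
    obtain ⟨q⟩ := hv
    exact hback q (Or.inl rfl)
  · intro hv
    have hoo'₂ : (openGraph ω₂).Reachable o o' := SimpleGraph.Adj.reachable
      ((openGraph_adj ω₂ o o').2 ⟨Or.inr rfl, hoo'.ne⟩)
    rcases hv with rfl | hvC
    · exact mem_openCluster_self _ _
    · obtain ⟨q⟩ := hvC
      exact hoo'₂.trans (hstay q (mem_openCluster_self ω o'))

end Surgery

/-! ### Positive probability of a nice light infinite cluster -/

section Positive

variable {G : SimpleGraph V} [G.LocallyFinite] {o : V} (hconn : G.Connected)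
  (htr : IsGraphTransitive G) (hU : ¬ IsGraphUnimodular G) [Countable V]
include hconn htr hU

omit htr hU [Countable V] in
/-- The event "`C(u)` is infinite and light with `u` uppermost" is carried by an automorphism
`γ` to the same event at `γ u`. [cite: Timar2006, §4 (proof of Thm. 4.3: "these events can be mapped into each other by some automorphisms")] -/
theorem relabel_mem_uppermost_iff (γ : G ≃g G) (u : V) (ω : BondConfig V) :
    BondConfig.relabel (sym2Equiv γ.toEquiv) ω ∈ {ω : BondConfig V | (openCluster ω (γ u)).Infinite ∧
        ¬ IsHeavy G o (openCluster ω (γ u)) ∧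
        ∀ v ∈ openCluster ω (γ u), autWeight G o v ≤ autWeight G o (γ u)} ↔
      ω ∈ {ω : BondConfig V | (openCluster ω u).Infinite ∧ ¬ IsHeavy G o (openCluster ω u) ∧
        ∀ v ∈ openCluster ω u, autWeight G o v ≤ autWeight G o u} := by
  simp only [Set.mem_setOf_eq, openCluster_relabel_iso γ ω u,
    Set.infinite_image_iff γ.injective.injOn, isHeavy_image_iff G hconn γ o]
  refine and_congr Iff.rfl (and_congr Iff.rfl ⟨fun h v hv => ?_, fun h v hv => ?_⟩)
  · exact (autWeight_map_le_map_iff hconn γ u v).1 (h (γ v) (Set.mem_image_of_mem _ hv))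
  · obtain ⟨v₀, hv₀, rfl⟩ := hv
    exact (autWeight_map_le_map_iff hconn γ u v₀).2 (h v₀ hv₀)

/-- **`q := P[F] > 0`** (p. 2354): for `0 < p < 1` on a connected, locally finite, transitive
nonunimodular graph, if it is not the case that almost surely every infinite cluster is heavy,
then with positive probability `C(o)` is infinite, light, and contained in `{o} ∪ {w ≤ Δ}`
(nice). [cite: Timar2006, §4 (proof of Thm. 4.3: q = P[F] > 0 by insertion and deletion tolerance)] -/
theorem measure_nice_pos {p : unitInterval} (hp0 : 0 < (p : ℝ)) (hp1 : (p : ℝ) < 1)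
    (hneg : ¬ ∀ᵐ ω ∂(bondPercolation G p), ∀ x : V,
      (openCluster ω x).Infinite → IsHeavy G o (openCluster ω x)) :
    0 < bondPercolation G p {ω | (openCluster ω o).Infinite ∧ ¬ IsHeavy G o (openCluster ω o) ∧
      openCluster ω o ⊆ insert o {v | autWeight G o v ≤ minNbrWeight G o}} := by
  classical
  set P := bondPercolation G p with hP
  -- the event at a vertex `u`: `C(u)` infinite, light, `u` uppermost
  set E : V → Set (BondConfig V) := fun u => {ω | (openCluster ω u).Infinite ∧
      ¬ IsHeavy G o (openCluster ω u) ∧ ∀ v ∈ openCluster ω u, autWeight G o v ≤ autWeight G o u}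
    with hE
  -- (1) some `E u` has positive probability
  have hpos : ∃ u, P (E u) ≠ 0 := by
    by_contra hall
    push Not at hall
    apply hneg
    rw [ae_iff]
    refine measure_mono_null ?_ (measure_iUnion_null_iff.2 hall)
    intro ω hω
    rw [Set.mem_setOf_eq] at hω
    push Not at hω
    obtain ⟨x, hinf, hlight⟩ := hω
    obtain ⟨u, hu, humax⟩ := exists_uppermost_of_light hconn hlight
    have hCu : openCluster ω u = openCluster ω x := by
      ext v
      exact ⟨fun h => hu.trans h, fun h => hu.symm.trans h⟩
    refine Set.mem_iUnion.2 ⟨u, ?_⟩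
    simp only [hE, Set.mem_setOf_eq, hCu]
    exact ⟨hinf, hlight, humax⟩
  obtain ⟨u₀, hu₀⟩ := hpos
  -- (2) move `u₀` to a neighbour `o′` of `o` one long edge below `o`
  obtain ⟨o', hoo', ho'w⟩ := exists_adj_autWeight_eq_mul hconn htr hU o o
  rw [autWeight_self G hconn o, mul_one] at ho'w
  obtain ⟨γ, hγ⟩ := htr u₀ o'
  have hEo' : P (E o') ≠ 0 := by
    have hpre : BondConfig.relabel (sym2Equiv γ.toEquiv) ⁻¹' E o' = E u₀ := by
      rw [← hγ]; exact Set.ext fun ω => relabel_mem_uppermost_iff hconn γ u₀ ω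
    have hmap : P (E u₀) = P (E o') := by
      rw [← hpre, ← MeasurableEquiv.map_apply, hP, bondPercolation_map_relabel_iso γ p]
    rwa [hmap] at hu₀
  -- (3) restrict to configurations on `E(G)` (full measure)
  have hωE : ∀ᵐ ω ∂P, ω ⊆ G.edgeSet := ProbabilityTheory.setBernoulli_ae_subset
  have hA : 0 < P.real (E o' ∩ {ω | ω ⊆ G.edgeSet}) := by
    rw [measureReal_def, ENNReal.toReal_pos_iff]
    refine ⟨pos_iff_ne_zero.2 fun h0 => hEo' ?_, measure_lt_top _ _⟩
    refine le_antisymm ?_ zero_le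
    calc P (E o') ≤ P (E o' ∩ {ω | ω ⊆ G.edgeSet}) :=
          measure_mono_ae (hωE.mono fun ω hω hmem => ⟨hmem, hω⟩)
      _ = 0 := h0
  -- (4) the target event is measurable
  have hFm : MeasurableSet {ω : BondConfig V | (openCluster ω o).Infinite ∧
      ¬ IsHeavy G o (openCluster ω o) ∧
      openCluster ω o ⊆ insert o {v | autWeight G o v ≤ minNbrWeight G o}} :=
    (measurableSet_infinite_openCluster o).inter
      ((measurableSet_isHeavy_openCluster G o o).compl.inter (measurableSet_openCluster_subset o _))
  -- (5) surgery: delete the edges at `o`, insert `{o, o′}`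
  set D : Finset (Sym2 V) := (G.neighborFinset o).image fun v => s(o, v) with hD
  have hI : (↑({s(o, o')} : Finset (Sym2 V)) : Set (Sym2 V)) ⊆ G.edgeSet := by
    simp [hoo']
  have hstep : 0 < P.real (openEdges ↑({s(o, o')} : Finset (Sym2 V)) ⁻¹'
      {ω : BondConfig V | (openCluster ω o).Infinite ∧ ¬ IsHeavy G o (openCluster ω o) ∧
        openCluster ω o ⊆ insert o {v | autWeight G o v ≤ minNbrWeight G o}}) := by
    refine bondPercolation_real_pos_of_closeEdges G hp1 D (measurable_openEdges _ hFm) hA ?_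
    rintro ω ⟨⟨hinf, hlight, hup⟩, hωG⟩
    rw [closeEdges]
    have hoC : o ∉ openCluster ω o' := by
      intro h
      have h1 := hup o h
      rw [autWeight_self G hconn o, ho'w] at h1
      exact absurd h1 (not_le.2 (minNbrWeight_lt_one hconn htr hU o))
    have hsurg := openCluster_surgery_eq (G := G) hωG hoo' hoC
    simp only [Set.mem_preimage, openEdges, Set.mem_setOf_eq, Finset.coe_singleton]
    rw [hsurg]
    refine ⟨(hinf.mono (Set.subset_insert _ _)), fun hheavy => hlight ?_, ?_⟩
    · -- `{o} ∪ C(o′)` heavy would make `C(o′)` heavy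
      rw [IsHeavy] at hheavy ⊢
      by_contra hne
      have hle := setWeight_insert_self_le (G := G) (o := o) o (openCluster ω o')
      rw [hheavy, top_le_iff] at hle
      exact ENNReal.add_ne_top.2 ⟨autWeight_ne_top G hconn o o, hne⟩ hle
    · refine Set.insert_subset_insert fun v hv => ?_
      show autWeight G o v ≤ minNbrWeight G o
      rw [← ho'w]; exact hup v hv
  have hfinal := bondPercolation_real_pos_of_openEdges G hp0 {s(o, o')} hI hFm hstep (fun ω hω => hω)
  rw [measureReal_def, ENNReal.toReal_pos_iff] at hfinal
  exact hfinal.1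

end Positive

end Literature.Barriers.CriticalPhenomena

end
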